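import Summits.HodgeConjecture.HodgeConjecture.Theorems.Ring2AbelianAllAndreBaseChangePencils
import HarnessLib

/-!
# Ring 2 · sub-cell AbelianAll (ALL ABELIAN VARIETIES), André axis, part XXXV-d — FINITE ÉTALE BASE CHANGE, THE ROWS: the lift
# `(L)_t(p)`, its every-point and CM-pointed forms, and transport (with its every-point and CM-pointed forms) of a compact pencil
# of abelian varieties `f : 𝒳 ⟶ S` DESCEND from the pulled-back pencil `𝒳 ×_S S' ⟶ S'` along every finite étale cover
# `g : S' ⟶ S` with `S'(ℂ)` connected, and the lift ASCENDS (hence is invariant) when the cover creates no new invariant classes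
# (`dim Im j'^*_{t'} ≤ dim Im j^*_{g(t')}`). FACT-FREE

HONEST FRAMING (page 1, verbatim): **research route, not a corollary; conditional on HC_CM plus one named
minimal statement.** Cell line: research route conditional on HC_CM; not a corollary; Q11.4-sentence-2 already
refuted in dim ≥ 3. Nothing in this file proves a case of the Hodge conjecture for an abelian variety; `HC_CM`, `HC_AV`
do not occur; no node is born (0 `def`), no named fact is used, no `sorry`; axioms standard; nothing is claimed minimal.

## What this part does (assembles part XXXV-c `Ring2AbelianAllAndreBaseChangePencils`)

Part XXXV-c proved the ENGINE `map_fiberι_complexGysin_fst_eq_zero`: along the base change `G : 𝒳 ×_S S' ⟶ 𝒳` of a compact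
abelian pencil by a connected finite étale cover of the base curve, `G_*` of a class dying on the fibres of the pulled-back
pencil `f'` dies on the fibres of `f`. Here:

* §1 **`comap_le_sup_of_baseChange`** — THE LIFT DESCENDS: `(L)_{t'}(p)` for `f'` gives `(L)_{g(t')}(p)` for `f`
  (`W ↦ G^* W`, algebraic on `(𝒳 ×_S S')_{t'} ≅ X_{g(t')}`; lift upstairs `G^* W = η' + κ'`; `κ'` dies on every fibre of `f'`,
  part XVII's `ker_map_fiberι_eq`; push down: `c • W = G_* G^* W = G_* η' + G_* κ'` with `c ≠ 0` the degree scalar of the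
  surjective equidimensional `G` (`exists_complexGysin_map_eq_smul_of_surjective`), `G_* η'` algebraic, `G_* κ'` dying on
  `X_{g(t')}` by the engine); every-point form `forall_comap_le_sup_of_baseChange` (`g` is onto on complex points);
  CM-pointed form `forall_cm_comap_le_sup_of_baseChange` (the CM locus pulls back, b05's `mem_cmLocus_familyPullback_snd_iff`).
* §2 **`comap_le_comap_of_baseChange`** — TRANSPORT DESCENDS (no Gysin needed: the fibres upstairs ARE the fibres
  downstairs, `fiberOverFamilyPullbackIso`; for this row `g` may be any morphism of bases); every-point and CM-pointed forms
  `forall_comap_le_comap_of_baseChange`, `forall_cm_comap_le_comap_of_baseChange`; the single-class form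
  `forall_map_fiberι_mem_of_baseChange`.

* §3 **`comap_le_sup_baseChange_of_forall_exists`** — THE LIFT ASCENDS WHEN THE COVER CREATES NO NEW INVARIANT CLASSES at
  `t'` (hypothesis `hinv`: every class upstairs agrees on the fibre over `t'` with some `G^* W`; `forall_exists_of_finrank_range_le`:
  it suffices that `dim Im j'^*_{t'} ≤ dim Im j^*_{g(t')}`), because `G^*` preserves algebraic classes (`G` finite,
  `map_fst_mem_algebraicClasses`); so under `hinv` the lift is INVARIANT, `comap_le_sup_baseChange_iff_of_forall_exists`.

So, per pencil, every André-axis statement of `f` may be CHECKED AFTER any connected finite étale base change (level structures,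
killing a finite monodromy quotient, pulling back to a cover where the family acquires extra structure) — as b05 proved for node X
— and the lift is an invariant of every base change that adds no invariant classes (in print: of every base change, once the
algebraic monodromy group is connected — a statement not made on the tree's carriers).

What is NOT claimed: the ASCENT in general (for `f` ⟹ for `f'` without `hinv`): upstairs the monodromy group is a finite-index
SUBGROUP, so `Im j'^*_{t'} ⊋ Im j_{g(t')}^*` may happen (finite monodromy killed) — more invariant classes are asked to lift, and
nothing here (or in print) derives that from downstairs (contrast: along fibrewise ISOGENIES both directions hold, parts
XXXIII-e/XXXIV/XXXV-a, because there the invariant subspaces correspond); that `hinv` holds for any named cover; connectedness of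
any monodromy group; anything minimal; any case of HC; any node-level statement (the nodes quantify over all pencils, a class
stable under base change, and gain nothing). EDGE LABELS: every row K (kernel, fact-free).

References: Andre1996Motifs (§5.3 p. 30 «remplacer S par un revêtement fini étale»; §5.1 p. 25; §6.3 Lemme 6.3.1); SGA1 (Exp. I
§9, Exp. XII Prop. 2.4); VoisinHodgeI2002 (§7.3.2 Remark 7.29); FultonYoungTableaux1997 (App. B §B.1 (5)–(7)); Fulton1998 (§1.7,
§19.2); Hartshorne1977 (II §3 base extension); Milne2020HodgeClassesAV (Prop. 1 p. 7); Abdulali1994FamiliesAV ((1.1) p. 1122);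
GrothendieckTopology1969 (§1).
-/

noncomputable section

set_option linter.dupNamespace false

namespace Summit.HodgeConjecture.HodgeConjecture.Ring2.AbelianAll

open CategoryTheory CategoryTheory.Limits AlgebraicGeometry MonoidalCategory CartesianMonoidalCategory
open Literature.AlgebraicGeometry Literature.AlgebraicGeometry.Motives
open Literature.AlgebraicGeometry.HodgeTheory
open Literature.AlgebraicGeometry.Deligne1982 (cmLocus)
open Summit.HodgeConjecture.HodgeConjecture.Theorems (isCompactAbelianPencil_familyPullback_snd mem_cmLocus_familyPullback_snd_iff)

variable {𝒳 S S' : SchemeOver ℂ} {d : ℕ} {f : 𝒳 ⟶ S}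

section BaseChange

variable (hf : IsCompactAbelianPencil f d) (g : S' ⟶ S) [IsFinite g.left] [Etale g.left] [ConnectedSpace (ComplexPoints S')]

/-! ## §1 The lift descends from the pulled-back pencil -/

include hf in
/-- **THE LIFT DESCENDS ALONG FINITE ÉTALE BASE CHANGE**: for a compact pencil of abelian `d`-folds `f : 𝒳 ⟶ S`, a finite étale
`g : S' ⟶ S` with `S'(ℂ)` connected, the pulled-back pencil `f' : 𝒳 ×_S S' ⟶ S'` and a point `t'` of `S'`: `(L)_{t'}(p)` for
`f'` gives `(L)_{g(t')}(p)` for `f`. For `W ∈ H²ᵖ(𝒳)` algebraic on `X_{g(t')}`: `G^* W` is algebraic on `(𝒳 ×_S S')_{t'} ≅ X_{g(t')}`,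
so `G^* W = η' + κ'` upstairs with `η'` algebraic and `κ'` dying on `(𝒳 ×_S S')_{t'}`, hence on every fibre of `f'` (part XVII,
`ker_map_fiberι_eq`); push down: `c • W = G_* G^* W = G_* η' + G_* κ'`, `c ≠ 0` (degree trick for the surjective
equidimensional `G`), `G_* η'` algebraic, `G_* κ'` dying on `X_{g(t')}` (part XXXV-c's engine). FACT-FREE.
[cite: Andre1996Motifs, §5.3 (p. 30)] [cite: Milne2020HodgeClassesAV, Prop. 1 (p. 7)] [cite: VoisinHodgeI2002, §7.3.2 Remark 7.29] -/
theorem comap_le_sup_of_baseChange {p : ℕ} (t' : ComplexPoints S')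
    (h : (algebraicClasses (fiberOver (familyPullback.snd f g) t') p).comap
        (complexBetti.map (fiberι (familyPullback.snd f g) t') (2 * p)).hom ≤
      algebraicClasses (familyPullback f g) p ⊔ LinearMap.ker (complexBetti.map (fiberι (familyPullback.snd f g) t') (2 * p)).hom) :
    (algebraicClasses (fiberOver f (AlgPoints.map g t')) p).comap (complexBetti.map (fiberι f (AlgPoints.map g t')) (2 * p)).hom ≤
      algebraicClasses 𝒳 p ⊔ LinearMap.ker (complexBetti.map (fiberι f (AlgPoints.map g t')) (2 * p)).hom := by
  have hf' := isCompactAbelianPencil_familyPullback_snd hf g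
  have hX := hf.isSmoothProjective_total
  have hX' := hf'.isSmoothProjective_total
  intro W hW
  by_cases hp : p ≤ d
  swap
  · -- above the top degree of the fibre everything dies on the fibre
    haveI := subsingleton_complexBetti (hf.isSmoothProjective_fiberOver (AlgPoints.map g t')) (k := 2 * p) (by omega)
    exact Submodule.mem_sup_right (by rw [LinearMap.mem_ker]; exact Subsingleton.elim _ _)
  -- upstairs: `G^* W` is algebraic on the fibre over `t'`
  have hW' : complexBetti.map (familyPullback.fst f g) (2 * p) W ∈
      (algebraicClasses (fiberOver (familyPullback.snd f g) t') p).comap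
        (complexBetti.map (fiberι (familyPullback.snd f g) t') (2 * p)).hom := by
    change complexBetti.map (fiberι (familyPullback.snd f g) t') (2 * p)
      (complexBetti.map (familyPullback.fst f g) (2 * p) W) ∈ algebraicClasses (fiberOver (familyPullback.snd f g) t') p
    rw [← complexBetti.map_comp_apply', ← fiberOverFamilyPullbackIso_hom_fiberι, complexBetti.map_comp_apply']
    exact (mem_algebraicClasses_map_iff_of_iso (fiberOverFamilyPullbackIso f g t')).2 hW
  obtain ⟨η', hη', κ', hκ', hsum⟩ := Submodule.mem_sup.1 (h hW')
  -- `κ'` dies on every fibre of `f'`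
  have hκ'all : ∀ s' : ComplexPoints S', complexBetti.map (fiberι (familyPullback.snd f g) s') (2 * p) κ' = 0 := by
    intro s'
    have hmem : κ' ∈ LinearMap.ker (complexBetti.map (fiberι (familyPullback.snd f g) s') (2 * p)).hom := by
      rw [ker_map_fiberι_eq hf' (2 * p) s' t']
      exact hκ'
    exact hmem
  -- push down: `c • W = G_* η' + G_* κ'`, `c ≠ 0`
  haveI := surjective_familyPullback_fst_left hf g
  obtain ⟨c, hc0, hc⟩ := exists_complexGysin_map_eq_smul_of_surjective complexOrientationFamily hX' hX (familyPullback.fst f g)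
  have hcW : c • W = complexGysin complexOrientationFamily hX' hX (familyPullback.fst f g) rfl η' +
      complexGysin complexOrientationFamily hX' hX (familyPullback.fst f g) rfl κ' := by
    rw [← hc (2 * p) rfl W, ← hsum, map_add]
  have hWeq : W = c⁻¹ • (complexGysin complexOrientationFamily hX' hX (familyPullback.fst f g) rfl η' +
      complexGysin complexOrientationFamily hX' hX (familyPullback.fst f g) rfl κ') := by
    rw [← hcW, smul_smul, inv_mul_cancel₀ hc0, one_smul]
  rw [hWeq]
  refine Submodule.smul_mem _ _ (Submodule.add_mem_sup ?_ ?_)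
  · exact complexGysin_mem_algebraicClasses_of_mem_algebraicClasses complexOrientationFamily hX' hX (familyPullback.fst f g) _ hη'
  · rw [LinearMap.mem_ker]
    exact map_fiberι_complexGysin_fst_eq_zero hf g hp hκ'all (AlgPoints.map g t')

include hf in
/-- **The every-point lift descends**: if `(L)_{t'}(p)` holds at every point of `S'` for the pulled-back pencil, then `(L)_t(p)`
holds at every point of `S` for `f` (`g` is onto on complex points). FACT-FREE. [cite: Milne2020HodgeClassesAV, Prop. 1 (p. 7)]
[cite: Andre1996Motifs, §5.3 (p. 30)] -/
theorem forall_comap_le_sup_of_baseChange (p : ℕ)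
    (h : ∀ t' : ComplexPoints S', (algebraicClasses (fiberOver (familyPullback.snd f g) t') p).comap
        (complexBetti.map (fiberι (familyPullback.snd f g) t') (2 * p)).hom ≤
      algebraicClasses (familyPullback f g) p ⊔ LinearMap.ker (complexBetti.map (fiberι (familyPullback.snd f g) t') (2 * p)).hom)
    (t : ComplexPoints S) :
    (algebraicClasses (fiberOver f t) p).comap (complexBetti.map (fiberι f t) (2 * p)).hom ≤
      algebraicClasses 𝒳 p ⊔ LinearMap.ker (complexBetti.map (fiberι f t) (2 * p)).hom := by
  obtain ⟨t', rfl⟩ := exists_map_eq_of_cover hf g t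
  exact comap_le_sup_of_baseChange hf g t' (h t')

include hf in
/-- **The CM-pointed lift (the pencil's share of `(L) CMFibreAlgebraicLift`) descends**: the lift at every CM point of the
pulled-back pencil gives the lift at every CM point of `f` (the CM locus pulls back, b05's `mem_cmLocus_familyPullback_snd_iff`).
FACT-FREE. [cite: Milne2020HodgeClassesAV, Prop. 1 (p. 7)] [cite: Andre1996Motifs, §5.3 (p. 30) and §6.3] -/
theorem forall_cm_comap_le_sup_of_baseChange (p : ℕ)
    (h : ∀ t' ∈ cmLocus (familyPullback.snd f g) d, (algebraicClasses (fiberOver (familyPullback.snd f g) t') p).comap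
        (complexBetti.map (fiberι (familyPullback.snd f g) t') (2 * p)).hom ≤
      algebraicClasses (familyPullback f g) p ⊔ LinearMap.ker (complexBetti.map (fiberι (familyPullback.snd f g) t') (2 * p)).hom)
    (t : ComplexPoints S) (ht : t ∈ cmLocus f d) :
    (algebraicClasses (fiberOver f t) p).comap (complexBetti.map (fiberι f t) (2 * p)).hom ≤
      algebraicClasses 𝒳 p ⊔ LinearMap.ker (complexBetti.map (fiberι f t) (2 * p)).hom := by
  obtain ⟨t', rfl⟩ := exists_map_eq_of_cover hf g t
  exact comap_le_sup_of_baseChange hf g t' (h t' ((mem_cmLocus_familyPullback_snd_iff f g d t').2 ht))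

/-! ## §2 Transport descends from the pulled-back pencil -/

omit [IsFinite g.left] [Etale g.left] [ConnectedSpace (ComplexPoints S')] in
/-- Restriction to the fibre of the pulled-back pencil over `t'` of a pulled-back class is algebraic iff the restriction of
the class to the fibre of `f` over `g(t')` is (the two fibres are isomorphic over the base change, `fiberOverFamilyPullbackIso`).
[cite: Hartshorne1977, II §3 (base extension)] [cite: GrothendieckTopology1969, §1] -/
theorem map_fiberι_map_fst_mem_iff (p : ℕ) (t' : ComplexPoints S') (W : complexBetti 𝒳 (2 * p)) :
    complexBetti.map (fiberι (familyPullback.snd f g) t') (2 * p) (complexBetti.map (familyPullback.fst f g) (2 * p) W) ∈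
        algebraicClasses (fiberOver (familyPullback.snd f g) t') p ↔
      complexBetti.map (fiberι f (AlgPoints.map g t')) (2 * p) W ∈ algebraicClasses (fiberOver f (AlgPoints.map g t')) p := by
  rw [← complexBetti.map_comp_apply', ← fiberOverFamilyPullbackIso_hom_fiberι, complexBetti.map_comp_apply']
  exact mem_algebraicClasses_map_iff_of_iso (fiberOverFamilyPullbackIso f g t')

omit [IsFinite g.left] [Etale g.left] [ConnectedSpace (ComplexPoints S')] in
/-- **TRANSPORT DESCENDS ALONG FINITE ÉTALE BASE CHANGE**: transport from `t'` to `s'` in degree `2p` along the pulled-back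
pencil gives transport from `g(t')` to `g(s')` along `f` (`W ↦ G^* W`; the fibres upstairs are the fibres downstairs; for this
row `g` may be any morphism of bases). FACT-FREE. [cite: Abdulali1994FamiliesAV, (1.1) (p. 1122)] [cite: Andre1996Motifs, §5.3 (p. 30)] -/
theorem comap_le_comap_of_baseChange {p : ℕ} (t' s' : ComplexPoints S')
    (h : (algebraicClasses (fiberOver (familyPullback.snd f g) t') p).comap
        (complexBetti.map (fiberι (familyPullback.snd f g) t') (2 * p)).hom ≤
      (algebraicClasses (fiberOver (familyPullback.snd f g) s') p).comap
        (complexBetti.map (fiberι (familyPullback.snd f g) s') (2 * p)).hom) :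
    (algebraicClasses (fiberOver f (AlgPoints.map g t')) p).comap (complexBetti.map (fiberι f (AlgPoints.map g t')) (2 * p)).hom ≤
      (algebraicClasses (fiberOver f (AlgPoints.map g s')) p).comap (complexBetti.map (fiberι f (AlgPoints.map g s')) (2 * p)).hom := by
  intro W hW
  have hW₀ : complexBetti.map (fiberι f (AlgPoints.map g t')) (2 * p) W ∈ algebraicClasses (fiberOver f (AlgPoints.map g t')) p :=
    hW
  have hW₁ : complexBetti.map (fiberι (familyPullback.snd f g) t') (2 * p) (complexBetti.map (familyPullback.fst f g) (2 * p) W) ∈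
      algebraicClasses (fiberOver (familyPullback.snd f g) t') p :=
    (map_fiberι_map_fst_mem_iff g p t' W).2 hW₀
  have hW₂ : complexBetti.map (fiberι (familyPullback.snd f g) s') (2 * p) (complexBetti.map (familyPullback.fst f g) (2 * p) W) ∈
      algebraicClasses (fiberOver (familyPullback.snd f g) s') p :=
    h hW₁
  have hW₃ : complexBetti.map (fiberι f (AlgPoints.map g s')) (2 * p) W ∈ algebraicClasses (fiberOver f (AlgPoints.map g s')) p :=
    (map_fiberι_map_fst_mem_iff g p s' W).1 hW₂
  exact hW₃

include hf in
/-- **The every-point transport (the pencil's share of the variational statements (2)/(3)) descends**: "every class of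
degree `2p` algebraic on one fibre is algebraic on all fibres" for the pulled-back pencil gives the same for `f`. FACT-FREE.
[cite: Abdulali1994FamiliesAV, (1.1) (p. 1122)] -/
theorem forall_comap_le_comap_of_baseChange (p : ℕ)
    (h : ∀ t' s' : ComplexPoints S', (algebraicClasses (fiberOver (familyPullback.snd f g) t') p).comap
        (complexBetti.map (fiberι (familyPullback.snd f g) t') (2 * p)).hom ≤
      (algebraicClasses (fiberOver (familyPullback.snd f g) s') p).comap
        (complexBetti.map (fiberι (familyPullback.snd f g) s') (2 * p)).hom)
    (t s : ComplexPoints S) :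
    (algebraicClasses (fiberOver f t) p).comap (complexBetti.map (fiberι f t) (2 * p)).hom ≤
      (algebraicClasses (fiberOver f s) p).comap (complexBetti.map (fiberι f s) (2 * p)).hom := by
  obtain ⟨t', rfl⟩ := exists_map_eq_of_cover hf g t
  obtain ⟨s', rfl⟩ := exists_map_eq_of_cover hf g s
  exact comap_le_comap_of_baseChange g t' s' (h t' s')

include hf in
/-- **The CM-pointed transport (the pencil's share of `(4) CMAnchoredTransport`) descends**: transport from every CM point of
the pulled-back pencil to every point gives transport from every CM point of `f` to every point. FACT-FREE.
[cite: Abdulali1994FamiliesAV, (1.1) (p. 1122)] [cite: Andre1996Motifs, §6.3 Lemme 6.3.1 (pp. 31–32)] -/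
theorem forall_cm_comap_le_comap_of_baseChange (p : ℕ)
    (h : ∀ t' ∈ cmLocus (familyPullback.snd f g) d, ∀ s' : ComplexPoints S',
      (algebraicClasses (fiberOver (familyPullback.snd f g) t') p).comap
          (complexBetti.map (fiberι (familyPullback.snd f g) t') (2 * p)).hom ≤
        (algebraicClasses (fiberOver (familyPullback.snd f g) s') p).comap
          (complexBetti.map (fiberι (familyPullback.snd f g) s') (2 * p)).hom)
    (t : ComplexPoints S) (ht : t ∈ cmLocus f d) (s : ComplexPoints S) :
    (algebraicClasses (fiberOver f t) p).comap (complexBetti.map (fiberι f t) (2 * p)).hom ≤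
      (algebraicClasses (fiberOver f s) p).comap (complexBetti.map (fiberι f s) (2 * p)).hom := by
  obtain ⟨t', rfl⟩ := exists_map_eq_of_cover hf g t
  obtain ⟨s', rfl⟩ := exists_map_eq_of_cover hf g s
  exact comap_le_comap_of_baseChange g t' s' (h t' ((mem_cmLocus_familyPullback_snd_iff f g d t').2 ht) s')

include hf in
/-- **The single-class transport form descends**: if every class of the pulled-back total space algebraic on the fibre over
`t'` is algebraic on all fibres of `f'`, then every class of `𝒳` algebraic on `X_{g(t')}` is algebraic on all fibres of `f`.
FACT-FREE. [cite: Abdulali1994FamiliesAV, (1.1) (p. 1122)] -/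
theorem forall_map_fiberι_mem_of_baseChange {p : ℕ} (t' : ComplexPoints S')
    (h : ∀ U' : complexBetti (familyPullback f g) (2 * p),
      complexBetti.map (fiberι (familyPullback.snd f g) t') (2 * p) U' ∈ algebraicClasses (fiberOver (familyPullback.snd f g) t') p →
        ∀ s' : ComplexPoints S', complexBetti.map (fiberι (familyPullback.snd f g) s') (2 * p) U' ∈
          algebraicClasses (fiberOver (familyPullback.snd f g) s') p)
    (W : complexBetti 𝒳 (2 * p))
    (hW : complexBetti.map (fiberι f (AlgPoints.map g t')) (2 * p) W ∈ algebraicClasses (fiberOver f (AlgPoints.map g t')) p)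
    (s : ComplexPoints S) : complexBetti.map (fiberι f s) (2 * p) W ∈ algebraicClasses (fiberOver f s) p := by
  obtain ⟨s', rfl⟩ := exists_map_eq_of_cover hf g s
  exact comap_le_comap_of_baseChange g t' s' (fun U' hU' ↦ h U' hU' s') hW


/-! ## §3 Ascent when the cover creates no new invariant classes -/

include hf in
/-- `G^*` preserves algebraic classes on the total spaces: `G` is finite (base change of the finite `g`), hence locally quasi-finite,
between smooth projective varieties of the same dimension `d + 1`. [cite: Fulton1998, §19.2 Cor. 19.2 (b) and §1.7]
[cite: GrothendieckTopology1969, §1] -/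
theorem map_fst_mem_algebraicClasses {p : ℕ} {η : complexBetti 𝒳 (2 * p)} (hη : η ∈ algebraicClasses 𝒳 p) :
    complexBetti.map (familyPullback.fst f g) (2 * p) η ∈ algebraicClasses (familyPullback f g) p := by
  haveI : IsFinite (familyPullback.fst f g).left := by
    rw [familyPullback.fst_left]
    exact MorphismProperty.pullback_fst (P := @IsFinite) _ _ ‹IsFinite g.left›
  exact map_mem_algebraicClasses_of_locallyQuasiFinite (isCompactAbelianPencil_familyPullback_snd hf g).isSmoothProjective_total
    hf.isSmoothProjective_total (familyPullback.fst f g) hη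

include hf in
/-- **THE LIFT ASCENDS when the cover creates NO NEW INVARIANT CLASSES at `t'`**: if every class of `H²ᵖ(𝒳 ×_S S')` agrees on
the fibre over `t'` with a pulled-back class `G^* W` (hypothesis `hinv`: `Im j'^*_{t'} = Im (j'^*_{t'} ∘ G^*)`, i.e. the monodromy of
the pulled-back pencil — a finite-index subgroup — has the same invariants; automatic once the algebraic monodromy group of `f` is
connected, a statement not made on the tree's carriers), then `(L)_{g(t')}(p)` for `f` gives `(L)_{t'}(p)` for the pulled-back
pencil: `W' ≡ G^* W` on the fibre, `W = η + κ` downstairs, `W' = G^* η + (W' − G^* η)` with `G^* η` algebraic and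
`j'^*_{t'}(W' − G^* η) = j'^*_{t'} G^* κ = 0` (the fibres agree). FACT-FREE. [cite: Andre1996Motifs, §5.3 (p. 30)]
[cite: Milne2020HodgeClassesAV, Prop. 1 (p. 7)] [cite: DeligneHodgeII1971, Cor. 4.2.8] -/
theorem comap_le_sup_baseChange_of_forall_exists {p : ℕ} (t' : ComplexPoints S')
    (hinv : ∀ W' : complexBetti (familyPullback f g) (2 * p), ∃ W : complexBetti 𝒳 (2 * p),
      complexBetti.map (fiberι (familyPullback.snd f g) t') (2 * p) W' =
        complexBetti.map (fiberι (familyPullback.snd f g) t') (2 * p) (complexBetti.map (familyPullback.fst f g) (2 * p) W))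
    (h : (algebraicClasses (fiberOver f (AlgPoints.map g t')) p).comap (complexBetti.map (fiberι f (AlgPoints.map g t')) (2 * p)).hom ≤
      algebraicClasses 𝒳 p ⊔ LinearMap.ker (complexBetti.map (fiberι f (AlgPoints.map g t')) (2 * p)).hom) :
    (algebraicClasses (fiberOver (familyPullback.snd f g) t') p).comap
        (complexBetti.map (fiberι (familyPullback.snd f g) t') (2 * p)).hom ≤
      algebraicClasses (familyPullback f g) p ⊔ LinearMap.ker (complexBetti.map (fiberι (familyPullback.snd f g) t') (2 * p)).hom := by
  intro W' hW'
  have hW'₀ : complexBetti.map (fiberι (familyPullback.snd f g) t') (2 * p) W' ∈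
      algebraicClasses (fiberOver (familyPullback.snd f g) t') p := hW'
  obtain ⟨W, hWW'⟩ := hinv W'
  -- downstairs: `W` is algebraic on `X_{g(t')}`, so `W = η + κ`
  have hW₁ : complexBetti.map (fiberι f (AlgPoints.map g t')) (2 * p) W ∈ algebraicClasses (fiberOver f (AlgPoints.map g t')) p := by
    rw [← map_fiberι_map_fst_mem_iff g p t' W, ← hWW']
    exact hW'₀
  obtain ⟨η, hη, κ, hκ, hsum⟩ := Submodule.mem_sup.1 (h hW₁)
  have hκ0 : complexBetti.map (fiberι f (AlgPoints.map g t')) (2 * p) κ = 0 := hκ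
  -- upstairs: `W' = G^* η + (W' − G^* η)`
  rw [show W' = complexBetti.map (familyPullback.fst f g) (2 * p) η + (W' - complexBetti.map (familyPullback.fst f g) (2 * p) η) by abel]
  refine Submodule.add_mem_sup (map_fst_mem_algebraicClasses hf g hη) ?_
  rw [LinearMap.mem_ker]
  change complexBetti.map (fiberι (familyPullback.snd f g) t') (2 * p)
    (W' - complexBetti.map (familyPullback.fst f g) (2 * p) η) = 0
  have hηeq : η = W - κ := by rw [← hsum]; abel
  rw [map_sub, hWW', hηeq, map_sub, map_sub, sub_sub_cancel, ← complexBetti.map_comp_apply',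
    ← fiberOverFamilyPullbackIso_hom_fiberι, complexBetti.map_comp_apply', hκ0, map_zero]

include hf in
/-- **Under `hinv` the lift is INVARIANT under the base change at `t'`**: `(L)_{t'}(p)` for the pulled-back pencil iff
`(L)_{g(t')}(p)` for `f` (§1 descent + ascent). FACT-FREE. [cite: Andre1996Motifs, §5.3 (p. 30)] [cite: Milne2020HodgeClassesAV, Prop. 1 (p. 7)] -/
theorem comap_le_sup_baseChange_iff_of_forall_exists {p : ℕ} (t' : ComplexPoints S')
    (hinv : ∀ W' : complexBetti (familyPullback f g) (2 * p), ∃ W : complexBetti 𝒳 (2 * p),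
      complexBetti.map (fiberι (familyPullback.snd f g) t') (2 * p) W' =
        complexBetti.map (fiberι (familyPullback.snd f g) t') (2 * p) (complexBetti.map (familyPullback.fst f g) (2 * p) W)) :
    (algebraicClasses (fiberOver (familyPullback.snd f g) t') p).comap
          (complexBetti.map (fiberι (familyPullback.snd f g) t') (2 * p)).hom ≤
        algebraicClasses (familyPullback f g) p ⊔ LinearMap.ker (complexBetti.map (fiberι (familyPullback.snd f g) t') (2 * p)).hom ↔
      (algebraicClasses (fiberOver f (AlgPoints.map g t')) p).comap (complexBetti.map (fiberι f (AlgPoints.map g t')) (2 * p)).hom ≤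
        algebraicClasses 𝒳 p ⊔ LinearMap.ker (complexBetti.map (fiberι f (AlgPoints.map g t')) (2 * p)).hom :=
  ⟨comap_le_sup_of_baseChange hf g t', comap_le_sup_baseChange_of_forall_exists hf g t' hinv⟩

include hf in
/-- **The hypothesis `hinv` in RANK FORM**: it holds as soon as the pulled-back pencil has no MORE invariant classes at `t'` than `f`
has at `g(t')` — `dim Im j'^*_{t'} ≤ dim Im j^*_{g(t')}` — since `Im (j'^*_{t'} ∘ G^*) ≤ Im j'^*_{t'}` always and the former has the
dimension of `Im j^*_{g(t')}` (the fibres agree). [cite: DeligneHodgeII1971, Thm. 4.1.1 and Cor. 4.2.8] [cite: VoisinHodgeII2003, §4.3.1 Thm. 4.18] -/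
theorem forall_exists_of_finrank_range_le {k : ℕ} (t' : ComplexPoints S')
    (hle : Module.finrank ℂ ↥(LinearMap.range (complexBetti.map (fiberι (familyPullback.snd f g) t') k).hom) ≤
      Module.finrank ℂ ↥(LinearMap.range (complexBetti.map (fiberι f (AlgPoints.map g t')) k).hom)) :
    ∀ W' : complexBetti (familyPullback f g) k, ∃ W : complexBetti 𝒳 k,
      complexBetti.map (fiberι (familyPullback.snd f g) t') k W' =
        complexBetti.map (fiberι (familyPullback.snd f g) t') k (complexBetti.map (familyPullback.fst f g) k W) := by
  have hf' := isCompactAbelianPencil_familyPullback_snd hf g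
  haveI : Module.Finite ℂ (complexBetti (fiberOver (familyPullback.snd f g) t') k) := finite_complexBetti (hf'.isSmoothProjective_fiberOver t') _
  set j' := (complexBetti.map (fiberι (familyPullback.snd f g) t') k).hom with hj'
  set G' := (complexBetti.map (familyPullback.fst f g) k).hom with hG'
  set e := fiberOverFamilyPullbackIso f g t' with he
  -- `Im (j' ∘ G^*) = e^*(Im j)` has the dimension of `Im j`
  have hcomp : j' ∘ₗ G' = (complexBetti.map e.hom k).hom ∘ₗ (complexBetti.map (fiberι f (AlgPoints.map g t')) k).hom := by
    ext W
    change complexBetti.map (fiberι (familyPullback.snd f g) t') k (complexBetti.map (familyPullback.fst f g) k W) =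
      complexBetti.map e.hom k (complexBetti.map (fiberι f (AlgPoints.map g t')) k W)
    rw [← complexBetti.map_comp_apply', ← fiberOverFamilyPullbackIso_hom_fiberι, complexBetti.map_comp_apply']
  have hinj : Function.Injective (complexBetti.map e.hom k).hom := complexBetti.map_injective_of_iso e k
  have h1 : LinearMap.range (j' ∘ₗ G') ≤ LinearMap.range j' := LinearMap.range_comp_le_range G' j'
  have h2 : Module.finrank ℂ ↥(LinearMap.range j') ≤ Module.finrank ℂ ↥(LinearMap.range (j' ∘ₗ G')) := by
    rw [hcomp, LinearMap.range_comp]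
    calc Module.finrank ℂ ↥(LinearMap.range j')
        ≤ Module.finrank ℂ ↥(LinearMap.range (complexBetti.map (fiberι f (AlgPoints.map g t')) k).hom) := hle
      _ = Module.finrank ℂ ↥((LinearMap.range (complexBetti.map (fiberι f (AlgPoints.map g t')) k).hom).map
            (complexBetti.map e.hom k).hom) :=
          (Submodule.equivMapOfInjective _ hinj _).finrank_eq
  have heq : LinearMap.range (j' ∘ₗ G') = LinearMap.range j' := Submodule.eq_of_le_of_finrank_le h1 h2
  intro W'
  have hmem : j' W' ∈ LinearMap.range (j' ∘ₗ G') := by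
    rw [heq]
    exact LinearMap.mem_range_self j' W'
  obtain ⟨W, hW⟩ := hmem
  exact ⟨W, hW.symm⟩

end BaseChange

end Summit.HodgeConjecture.HodgeConjecture.Ring2.AbelianAll

end
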